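import Mathlib
import Literature.Analysis.ODE.ExponentialTails
import HarnessLib

/-!
# Polynomials against exponentials on left half-lines

Topic `Literature/Analysis/ODE` (namespace `Literature.Analysis.ODE`).  Bookkeeping used by the
asymptotic integration of `u'' = V u + F` at an exponentially regular left end
(`PolyharmonicHalfLineLevel.lean`, `PolyharmonicHalfLine.lean`; Hartman, Ch. X §1, §17):

* `exists_polynomial_derivative_eq`, `exists_polynomial_derivative_derivative_eq` — polynomial
  (second) primitives;
* `tendsto_pow_mul_exp_mul_atBot`, `tendsto_eval_mul_exp_mul_atBot` — `P(x) e^{δx} → 0` as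
  `x → −∞` (`δ > 0`), hence `exists_abs_eval_le_mul_exp_neg`: `|P(x)| ≤ C e^{−δ x}` on `(−∞, X]`;
* `exists_pos_le_abs_eval_of_ne_zero` — a non-zero polynomial is bounded away from `0` near `−∞`;
  `polynomial_eq_zero_of_eval_eq_zero_Iio`;
* `integral_abs_comp_sub_le` — `∫_0^S |c(X − s)| ds ≤ C e^{γX}/γ` for `|c| ≤ C e^{γ x}` on `(−∞, X]`.

Everything is proved; no definitions.

## References

* P. Hartman, *Ordinary Differential Equations*, SIAM Classics 38 (2002), Ch. X §1
  (key `Hartman2002`).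
-/

namespace Literature.Analysis.ODE

open _root_.MeasureTheory _root_.Set _root_.Filter _root_.Topology intervalIntegral Polynomial

noncomputable section

/-! ### Polynomial bookkeeping -/

/-- Every real polynomial has a polynomial primitive. [folklore] -/
theorem exists_polynomial_derivative_eq (Q : ℝ[X]) : ∃ P : ℝ[X], derivative P = Q := by
  induction Q using Polynomial.induction_on' with
  | add p q hp hq =>
      obtain ⟨P, hP⟩ := hp
      obtain ⟨R, hR⟩ := hq
      exact ⟨P + R, by rw [derivative_add, hP, hR]⟩
  | monomial n a =>
      refine ⟨monomial (n + 1) (a / (n + 1)), ?_⟩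
      rw [derivative_monomial]
      have hn : ((n : ℝ) + 1) ≠ 0 := by positivity
      simp only [Nat.add_sub_cancel, Nat.cast_add, Nat.cast_one]
      congr 1
      field_simp

/-- Every real polynomial has a polynomial second primitive. [folklore] -/
theorem exists_polynomial_derivative_derivative_eq (Q : ℝ[X]) :
    ∃ P : ℝ[X], derivative (derivative P) = Q := by
  obtain ⟨P₁, h₁⟩ := exists_polynomial_derivative_eq Q
  obtain ⟨P, h⟩ := exists_polynomial_derivative_eq P₁
  exact ⟨P, by rw [h, h₁]⟩

/-- `x^k e^{δ x} → 0` as `x → −∞` (`δ > 0`). [folklore] -/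
theorem tendsto_pow_mul_exp_mul_atBot (k : ℕ) {δ : ℝ} (hδ : 0 < δ) :
    Tendsto (fun x : ℝ => x ^ k * Real.exp (δ * x)) atBot (𝓝 0) := by
  -- `y ↦ (δ y)^k e^{-δ y} → 0` at `+∞`, then `x = -y`
  have h1 : Tendsto (fun y : ℝ => (δ * y) ^ k * Real.exp (-(δ * y))) atTop (𝓝 0) :=
    (Real.tendsto_pow_mul_exp_neg_atTop_nhds_zero k).comp (tendsto_id.const_mul_atTop hδ)
  have h2 : Tendsto (fun y : ℝ => ((-1 : ℝ) ^ k / δ ^ k) * ((δ * y) ^ k * Real.exp (-(δ * y))))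
      atTop (𝓝 0) := by
    simpa using h1.const_mul ((-1 : ℝ) ^ k / δ ^ k)
  have h3 := h2.comp tendsto_neg_atBot_atTop
  refine h3.congr fun x => ?_
  simp only [Function.comp_apply]
  have hδ0 : δ ^ k ≠ 0 := pow_ne_zero k hδ.ne'
  have hsq : ((-1 : ℝ)) ^ (k * 2) = 1 := by
    rw [mul_comm, pow_mul, neg_one_sq, one_pow]
  have hexp : Real.exp (-(δ * -x)) = Real.exp (δ * x) := by ring_nf
  rw [hexp, mul_pow, show (-x) ^ k = (-1 : ℝ) ^ k * x ^ k by rw [← neg_one_mul, mul_pow]]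
  field_simp
  linear_combination (x ^ k) * hsq

/-- `P(x) e^{δ x} → 0` as `x → −∞` for every polynomial `P` (`δ > 0`). [folklore] -/
theorem tendsto_eval_mul_exp_mul_atBot (P : ℝ[X]) {δ : ℝ} (hδ : 0 < δ) :
    Tendsto (fun x : ℝ => P.eval x * Real.exp (δ * x)) atBot (𝓝 0) := by
  have h : ∀ x : ℝ, P.eval x * Real.exp (δ * x)
      = ∑ i ∈ Finset.range (P.natDegree + 1), P.coeff i * (x ^ i * Real.exp (δ * x)) := by
    intro x
    rw [eval_eq_sum_range, Finset.sum_mul]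
    refine Finset.sum_congr rfl fun i _ => by ring
  simp_rw [h]
  have := tendsto_finsetSum (Finset.range (P.natDegree + 1))
    (fun i _ => (tendsto_pow_mul_exp_mul_atBot i hδ).const_mul (P.coeff i))
  simpa using this

/-- **Polynomials are `O(e^{−δ x})` on left half-lines**: for every `δ > 0` and `X` there is
`C ≥ 0` with `|P(x)| ≤ C e^{−δ x}` for all `x ≤ X`. [folklore] -/
theorem exists_abs_eval_le_mul_exp_neg (P : ℝ[X]) {δ : ℝ} (hδ : 0 < δ) (X : ℝ) :
    ∃ C : ℝ, 0 ≤ C ∧ ∀ x ≤ X, |P.eval x| ≤ C * Real.exp (-δ * x) := by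
  have ht := tendsto_eval_mul_exp_mul_atBot P hδ
  -- eventually `|P(x) e^{δx}| ≤ 1`
  have ht0 : Tendsto (fun x => |P.eval x * Real.exp (δ * x)|) atBot (𝓝 0) := by
    simpa using ht.abs
  have hev : ∀ᶠ x in atBot, |P.eval x * Real.exp (δ * x)| ≤ 1 :=
    ht0.eventually (ge_mem_nhds zero_lt_one)
  obtain ⟨X₁, hX₁⟩ := eventually_atBot.1 hev
  -- on `[X₁, X]` the continuous function is bounded
  have hcont : Continuous fun x : ℝ => P.eval x * Real.exp (δ * x) :=
    (Polynomial.continuous P).mul (by fun_prop)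
  obtain ⟨B, hB⟩ := isCompact_Icc.exists_bound_of_continuousOn
    (hcont.continuousOn (s := Icc X₁ X))
  refine ⟨max 1 B, le_max_of_le_left zero_le_one, fun x hx => ?_⟩
  have key : |P.eval x * Real.exp (δ * x)| ≤ max 1 B := by
    rcases le_or_gt x X₁ with h | h
    · exact (hX₁ x h).trans (le_max_left _ _)
    · have := hB x ⟨h.le, hx⟩
      rw [Real.norm_eq_abs] at this
      exact this.trans (le_max_right _ _)
  rw [abs_mul, abs_of_pos (Real.exp_pos _)] at key
  have hexp : Real.exp (δ * x) * Real.exp (-δ * x) = 1 := by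
    rw [← Real.exp_add]; simp
  calc |P.eval x| = |P.eval x| * Real.exp (δ * x) * Real.exp (-δ * x) := by
        rw [mul_assoc, hexp, mul_one]
    _ ≤ max 1 B * Real.exp (-δ * x) :=
        mul_le_mul_of_nonneg_right key (Real.exp_pos _).le

/-- A non-zero polynomial is bounded away from zero near `−∞`. [folklore] -/
theorem exists_pos_le_abs_eval_of_ne_zero {P : ℝ[X]} (hP : P ≠ 0) :
    ∃ δ : ℝ, 0 < δ ∧ ∃ X₁ : ℝ, ∀ x ≤ X₁, δ ≤ |P.eval x| := by
  rcases lt_or_ge 0 P.degree with hdeg | hdeg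
  · have ht := Polynomial.abs_tendsto_atBot P hdeg
    obtain ⟨X₁, hX₁⟩ := eventually_atBot.1 (ht.eventually_ge_atTop 1)
    exact ⟨1, one_pos, X₁, hX₁⟩
  · have hC : P = C (P.coeff 0) := eq_C_of_degree_le_zero hdeg
    have hc : P.coeff 0 ≠ 0 := by
      intro h0
      rw [h0, map_zero] at hC
      exact hP hC
    refine ⟨|P.coeff 0|, abs_pos.2 hc, 0, fun x _ => ?_⟩
    rw [hC, eval_C]
    simp

/-- A polynomial vanishing on a left half-line is zero. [folklore] -/
theorem polynomial_eq_zero_of_eval_eq_zero_Iio {P : ℝ[X]} {X : ℝ} (h : ∀ x < X, P.eval x = 0) :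
    P = 0 := by
  refine P.eq_zero_of_infinite_isRoot ?_
  have hsub : Iio X ⊆ {x | IsRoot P x} := fun x hx => h x hx
  exact (Iio_infinite X).mono hsub

/-! ### Integrals of exponential bounds read leftwards from `X` -/

/-- `∫_0^S |c(X − s)| ds ≤ C e^{γ X}/γ` when `|c(x)| ≤ C e^{γ x}` for `x ≤ X` (`S ≥ 0`, `γ > 0`,
`c` continuous). [folklore] -/
theorem integral_abs_comp_sub_le {c : ℝ → ℝ} (hc : Continuous c) {C γ X : ℝ} (hγ : 0 < γ)
    (hb : ∀ x ≤ X, |c x| ≤ C * Real.exp (γ * x)) {S : ℝ} (hS : 0 ≤ S) :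
    ∫ s in (0 : ℝ)..S, |c (X - s)| ≤ C * Real.exp (γ * X) / γ := by
  have hC : 0 ≤ C := nonneg_of_abs_le_mul_exp (hb X le_rfl)
  have h1 : ∫ s in (0 : ℝ)..S, |c (X - s)| ≤ ∫ s in (0 : ℝ)..S, C * Real.exp (γ * (X - s)) := by
    refine intervalIntegral.integral_mono_on hS ?_ ?_ fun s hs => hb (X - s) (by linarith [hs.1])
    · exact ((continuous_abs.comp (hc.comp (continuous_const.sub continuous_id)))).intervalIntegrable
        _ _
    · exact (by fun_prop : Continuous fun s => C * Real.exp (γ * (X - s))).intervalIntegrable _ _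
  have h2 : ∫ s in (0 : ℝ)..S, C * Real.exp (γ * (X - s))
      = C * Real.exp (γ * X) / γ - C * Real.exp (γ * (X - S)) / γ := by
    have hderiv : ∀ s ∈ uIcc (0 : ℝ) S,
        HasDerivAt (fun s => -(C * Real.exp (γ * (X - s)) / γ)) (C * Real.exp (γ * (X - s))) s := by
      intro s _
      have h1 : HasDerivAt (fun s => γ * (X - s)) (-γ) s := by
        simpa using ((hasDerivAt_id s).const_sub X).const_mul γ
      have h2 := ((h1.exp.const_mul C).div_const γ).neg
      refine h2.congr_deriv ?_
      field_simp
    rw [integral_eq_sub_of_hasDerivAt hderiv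
      ((by fun_prop : Continuous fun s => C * Real.exp (γ * (X - s))).intervalIntegrable _ _)]
    simp only [sub_zero]
    ring
  have h3 : 0 ≤ C * Real.exp (γ * (X - S)) / γ := by positivity
  linarith

end

end Literature.Analysis.ODE
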